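import Mathlib.Combinatorics.SimpleGraph.Coloring.Vertex
import Mathlib.Combinatorics.SimpleGraph.Clique
import Mathlib.FieldTheory.Finite.Basic
import Summits.Ventures.DiscreteObjects.UnitDistance.UnitCircleGraph
import Summits.Ventures.DiscreteObjects.UnitDistance.UnitQuadranceIndependence
import HarnessLib

/-!
# The unit-quadrance graph over `F₂₇` — the one residue field left open by the reduction atlas (typed census statements)

Framing (verbatim for the cell): lottery ticket; floor = certified bounds/negative ranges.

Madore's reduction (`ValuationRingReduction.lean`) bounds `χ(K²)` by `χ(unitCircleGraph k)` for every residue field `k` of `K` in which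
`−1` is a non-square, i.e. `|k| = q ≡ 3 (mod 4)`.  The (U) census atlas (TABLE-U3/U4/U5) decides every such `q` except one: `q ∈ {3,7,11,19}`
give `χ ≤ 5` ('killer' residue fields, kernel colourings in `FiniteFieldColourings.lean` / `FiniteFieldObstruction.lean`), the primes
`23, 31, 43, 47` give `χ ≥ 6` (exact SDP certificates), all `q ≥ 67` give `χ ≥ 6` by the Weil bound and Hoffman, `q = 243, 343` by exact
spectra — and `q = 27` is UNDECIDED: `UD(F₂₇²) = Cay(F₃⁶, 14 lines)`, 729 vertices, 28-regular, `114 ≤ α ≤ 148` and `5 ≤ χ ≤ 7` certified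
(explicit sets/colourings; exact 3-point SDP certificate `cert27_t1485.json`, sha256 `0584de0a…2657`, cell files
`pub-namedobj-udg-g5/CERT27-METHOD.md`, `certs/udg5/alpha27-3pt/`), the full 3-point level stopping at `≈ 147.7 > 145.8`.
This file types the statements for an ARBITRARY field with 27 elements (all are isomorphic) and records the reductions to `χ ≥ 5 / 6`
through the counting lemma of `UnitQuadranceIndependence.lean`; the numerical inputs are CERTIFICATE-BACKED `Prop`s, not kernel facts.
-/

namespace Summit.Ventures.DiscreteObjects.UnitDistance

open SimpleGraph

/-- `unitCircleGraph F` has `q²` vertices when `|F| = q`. -/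
theorem card_vertices_unitCircleGraph_of_card {F : Type*} [CommRing F] [Fintype F] {q : ℕ} (hq : Fintype.card F = q) :
    Fintype.card (F × F) = q ^ 2 := by
  rw [Fintype.card_prod, hq, sq]

/-- Counting criterion over any finite coordinate ring: `α(unitCircleGraph F) ≤ a` and `k · a < q²` (`|F| = q`) give `k + 1 ≤ χ`. -/
theorem succ_le_chromaticNumber_unitCircleGraph_of_card {F : Type*} [CommRing F] [Fintype F] {q k a : ℕ}
    (hq : Fintype.card F = q) (ha : (unitCircleGraph F).indepNum ≤ a) (h : k * a < q ^ 2) :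
    (k + 1 : ℕ∞) ≤ (unitCircleGraph F).chromaticNumber := by
  have h' : k * a < Fintype.card (F × F) := by rwa [card_vertices_unitCircleGraph_of_card hq]
  exact_mod_cast succ_le_chromaticNumber_of_indepNum_le (unitCircleGraph F) ha h'

/-- CERTIFICATE-BACKED STATEMENT (typed, not kernel-proved): every field with 27 elements has `α(unitCircleGraph F) ≤ 148`.
Established for `F₃[t]/(t³ − t − 1)` by the exact 3-point SDP certificate `cert27_t1485.json` (integer Gram factors in the `C₂₈` Fourier
blocks, column sums evaluated in `ℤ[ζ₂₈]`, rigorous enclosure `UB ≤ 148.551578806`); all fields of order 27 are isomorphic and a ring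
isomorphism induces a graph isomorphism of unit-circle graphs.  (Hoffman/Delsarte give only `162`.) -/
def alpha_udF27_le_148 : Prop :=
  ∀ (F : Type) [Field F] [Fintype F], Fintype.card F = 27 → (unitCircleGraph F).indepNum ≤ 148

/-- OPEN census statement: `α(unitCircleGraph F) ≤ 145` for the fields with 27 elements.  It would make `F₂₇` a NON-killer
residue field (`χ ≥ 6`, `six_le_chromaticNumber_udF27_of`) and complete the sentence 'the killer residue fields are exactly
`F₃, F₇, F₁₁, F₁₉`'.  Status 2026-08-21: the full 3-point SDP level gives ≈ 147.7 (X block; the complement block, triangle rows and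
5-cycle rows are inactive; 60 × 60 partial 4-point blocks give no gain); the 4-point level is expected to suffice (as at `p = 23`: 108.5 → 102.2). -/
def alpha_udF27_le_145 : Prop :=
  ∀ (F : Type) [Field F] [Fintype F], Fintype.card F = 27 → (unitCircleGraph F).indepNum ≤ 145

/-- From the certified bound: `4 · 148 = 592 < 729`, so `χ(unitCircleGraph F) ≥ 5` for `|F| = 27` (also visible from Hoffman's `162`). -/
theorem five_le_chromaticNumber_udF27_of (h : alpha_udF27_le_148) (F : Type) [Field F] [Fintype F] (hF : Fintype.card F = 27) :
    (5 : ℕ∞) ≤ (unitCircleGraph F).chromaticNumber :=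
  succ_le_chromaticNumber_unitCircleGraph_of_card (k := 4) hF (h F hF) (by norm_num)

/-- The reduction for the open statement: `5 · 145 = 725 < 729`, so `alpha_udF27_le_145` gives `χ(unitCircleGraph F) ≥ 6` for every
field `F` with 27 elements — `F₂₇` would then not be a killer residue field. -/
theorem six_le_chromaticNumber_udF27_of (h : alpha_udF27_le_145) (F : Type) [Field F] [Fintype F] (hF : Fintype.card F = 27) :
    (6 : ℕ∞) ≤ (unitCircleGraph F).chromaticNumber :=
  succ_le_chromaticNumber_unitCircleGraph_of_card (k := 5) hF (h F hF) (by norm_num)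

end Summit.Ventures.DiscreteObjects.UnitDistance
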